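import Literature.Analysis.FluidPDE.LerayHopfMild
import Literature.Analysis.FluidPDE.LerayHopfH1TestForced
import HarnessLib

/-!
# Leray–Hopf solutions of the FORCED system are mild solutions (duality form): the proof

Analysis/FluidPDE support file: the **forced twin** of the main theorem of
`Literature/Analysis/FluidPDE/LerayHopfMild.lean` (`IsLerayHopfOn.integral_inner_eq_mild`, which
hard-codes `f = 0`). It serves PATH A of the discharge of Tao's forced unconditional uniqueness
theorem `Literature.Analysis.FluidPDE.tao2011_forced_unconditionalUniqueness_velocity`
(Tao 2011, Cor. 11.4): the one remaining analytic input there is the forced bounded-total-speed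
estimate (Tao 2011, Prop. 9.1), whose printed proof STARTS from the Duhamel formula (9.2) for the
forced system, `u(t) = e^{tνΔ}u₀ + ∫₀ᵗ e^{(t-τ)νΔ}(-P∇·(u ⊗ u) + Pf)(τ) dτ`, in its tested
(duality) form.

**Main result** (proved). Let `E` be a finite-dimensional real inner product space with
`dim E = 3`, `0 < ν`, `0 < T`, `u₀ ∈ L²(E; E)`, `f ∈ L²((0,T) × E; E)` jointly a.e.-strongly
measurable, and `u` a Leray–Hopf weak solution of the forced Navier–Stokes system on `E × [0, T)`
with datum `u₀` and force `f` (accepted `IsLerayHopfOn T ν f u₀ u`) whose slices are uniformly in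
`L²`, `sup_{[0,T]} ‖u(s)‖₂ ≤ M < ∞` (for `f = 0` this is the energy inequality; with force it is
the forced energy inequality plus Gronwall, and it is part of Tao's class: finite energy).

* `IsLerayHopfOn.integral_inner_eq_mild_forced`: for every smooth compactly supported
  divergence-free `φ` and every `t ∈ (0, T]`,
  `⟨u(t), φ⟩ = ⟨u₀, e^{νtΔ}φ⟩ + ∫_{(0,t]} ⟨u(τ), (u(τ)·∇) e^{ν(t-τ)Δ}φ⟩ dτ
      + ∫_{(0,t]} ⟨f(τ), e^{ν(t-τ)Δ}φ⟩ dτ`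
  (Fabes–Jones–Rivière 1972, Thm. 2.1, (i) ⇒ (ii), with force; Lemarié-Rieusset 2016, Prop. 6.5
  with Thm. 6.1; Tao 2011, (9.2) tested against `φ`, the Leray projector being invisible on
  divergence-free tests).

## Proof

Verbatim the Riemann-sum proof of `LerayHopfMild` (see that file's module docstring), with two
additions. (1) The frozen-test step uses the accepted FORCED `H¹_σ` time-slice identity
`IsLerayHopfOn.inner_weakGrad_test_eq_forced` (`LerayHopfH1TestForced`), whose integrand carries
the extra force pairing `P(σ, τ) = ⟨f(τ), ψ(σ)⟩`, `ψ(σ) = e^{ν(t-σ)Δ}φ`. (2) In the dominated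
convergence, `|P(σ, τ)| ≤ ‖f(τ)‖₂ ‖φ‖₂` (heat-flow `L²` contraction), which is integrable on
`(0, t)` because `∫₀ᵀ ‖f(τ)‖₂ dτ < ∞` for an `L²((0,T) × E)` force
(`lintegral_eLpNorm_two_slice_lt_top_of_eLpNorm_prod`), and
`|P(σ, τ) - P(τ, τ)| ≤ ‖f(τ)‖₂ (τ - σ) ν ‖Δφ‖₂ → 0` along the mesh by the `L²`-Lipschitz
continuity of `σ ↦ ψ(σ)` (`eLpNorm_heatTest_sub_le`). The diagonal pairing `τ ↦ ⟨f(τ), ψ(τ)⟩`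
is measurable (joint continuity of `(σ, x) ↦ ψ(σ)(x)`, Fubini) and dominated by `‖f(τ)‖₂‖φ‖₂`,
so the limit integral splits into the printed two Duhamel terms.

## References

* E. B. Fabes, B. F. Jones, N. M. Rivière, *The initial value problem for the Navier–Stokes
  equations with data in `L^p`*, Arch. Rational Mech. Anal. 45 (1972) 222–240, Thm. 2.1
  (`FabesJonesRiviere1972`).
* P. G. Lemarié-Rieusset, *The Navier–Stokes Problem in the 21st Century*, CRC Press (2016),
  Prop. 6.5, Thm. 6.1 (`LemarieRieusset2016`).
* T. Tao, *Localisation and compactness properties of the Navier–Stokes global regularity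
  problem*, Anal. PDE 6 (2013) 25–107, arXiv:1108.1165, §9, (9.2) (`Tao2011`).
-/

noncomputable section

open MeasureTheory TopologicalSpace Set Function Filter Topology InnerProductSpace
open scoped RealInnerProductSpace ENNReal NNReal Laplacian ContDiff

namespace Literature.Analysis.FluidPDE

variable {E : Type*} [NormedAddCommGroup E] [InnerProductSpace ℝ E] [FiniteDimensional ℝ E]
  [MeasurableSpace E] [BorelSpace E]

section MainForced

variable {T ν : ℝ} {f : ℝ → E → E} {u₀ : E → E} {u : ℝ → E → E}

/-- **Leray–Hopf solutions of the forced system are mild solutions (tested Duhamel formula)**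
(Fabes–Jones–Rivière 1972, Thm. 2.1 (i) ⇒ (ii), with force; Tao 2011, (9.2)). Let `dim E = 3`,
`0 < ν`, `0 < T`, `u₀ ∈ L²`, `f ∈ L²((0,T) × E)` jointly a.e.-strongly measurable, and `u` a
Leray–Hopf weak solution of the forced Navier–Stokes system on `E × [0,T)` with datum `u₀`, force
`f` and `sup_{s ∈ [0,T]} ‖u(s)‖₂ ≤ M < ∞`. Then for every smooth compactly supported
divergence-free `φ` and every `t ∈ (0, T]`,
`⟨u(t), φ⟩ = ⟨u₀, e^{νtΔ}φ⟩ + ∫_{(0,t]} ⟨u(τ), (u(τ)·∇)e^{ν(t-τ)Δ}φ⟩ dτ + ∫_{(0,t]} ⟨f(τ), e^{ν(t-τ)Δ}φ⟩ dτ`.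
[cite: FabesJonesRiviere1972, Thm. 2.1; Tao2011, §9 (9.2)] -/
theorem IsLerayHopfOn.integral_inner_eq_mild_forced (hE3 : Module.finrank ℝ E = 3)
    (hu : IsLerayHopfOn T ν f u₀ u) (hu₀ : MemLp u₀ 2 volume) (hν : 0 < ν) (hT : 0 < T)
    (hfm : AEStronglyMeasurable (uncurry f) ((volume.restrict (Ioo 0 T)).prod (volume : Measure E)))
    (hf2 : eLpNorm (uncurry f) 2 ((volume.restrict (Ioo 0 T)).prod (volume : Measure E)) < ⊤)
    {M : ℝ≥0∞} (hMtop : M ≠ ⊤) (hM : ∀ s ∈ Icc 0 T, eLpNorm (u s) 2 volume ≤ M)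
    {φ : E → E} (hφ : FunctionSpaces.IsTestFunctionOn (⊤ : Opens E) φ)
    (hdiv : VectorCalculus.IsDivFree φ) {t : ℝ} (ht : t ∈ Ioc 0 T) :
    ∫ x, ⟪u t x, φ x⟫ = (∫ x, ⟪u₀ x, heatTest ν φ t x⟫) +
      (∫ τ in Ioc 0 t, ∫ x, ⟪u τ x, convect (u τ) (heatTest ν φ (t - τ)) x⟫) +
      ∫ τ in Ioc 0 t, ∫ x, ⟪f τ x, heatTest ν φ (t - τ) x⟫ := by
  set b := stdOrthonormalBasis ℝ E with hb
  have hb1 : ∀ i, ‖b i‖ = 1 := fun i => b.orthonormal.1 i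
  have htT : t ≤ T := ht.2
  have ht0 : 0 < t := ht.1
  -- ### a jointly measurable weak-gradient witness of finite dissipation
  obtain ⟨G, hG, hG₂, -, -⟩ := hu.weakGrad_energy
  obtain ⟨Gu, hGum, hGuae⟩ := exists_stronglyMeasurable_weakGradient hu.weak.1 hG
  have hGu : ∀ᵐ τ ∂(volume.restrict (Ioo 0 T)), HasWeakGradient (u τ) (Gu τ) := by
    filter_upwards [hG, hGuae] with τ h1 h2
    exact h1.congr_grad_ae h2
  have hDeq : ∀ᵐ τ ∂(volume.restrict (Ioo 0 T)),
      ∫⁻ x, ENNReal.ofReal (frobeniusNormSq (Gu τ x)) =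
        ∫⁻ x, ENNReal.ofReal (frobeniusNormSq (G τ x)) := by
    filter_upwards [hGuae] with τ hτ
    exact lintegral_congr_ae (by filter_upwards [hτ] with x hx; rw [hx])
  have hGu₂ : ∫⁻ τ in Ioo 0 T, ∫⁻ x, ENNReal.ofReal (frobeniusNormSq (Gu τ x)) < ⊤ := by
    rw [lintegral_congr_ae hDeq]; exact hG₂
  -- ### `L²` slices
  have hL2 : ∀ s ∈ Icc 0 T, MemLp (u s) 2 volume := hu.memLp
  have hφ2 : ContDiff ℝ 2 φ := contDiff_infty.1 hφ.contDiff 2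
  -- ### the caloric test field `ψ σ = e^{ν(t-σ)Δ}φ` and its gradient
  set ψ : ℝ → E → E := fun σ => heatTest ν φ (t - σ) with hψ
  set Gψ : ℝ → E → E →L[ℝ] E := fun σ => fderiv ℝ (ψ σ) with hGψ
  have hψ2 : ∀ σ, MemLp (ψ σ) 2 volume := fun σ => memLp_heatTest hφ ν _
  have hψdiv : ∀ σ, IsWeaklyDivFree (ψ σ) := fun σ => isWeaklyDivFree_heatTest hφ hdiv ν _
  have hψG : ∀ σ, HasWeakGradient (ψ σ) (Gψ σ) := fun σ => hasWeakGradient_heatTest hφ ν _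
  have hGψ2 : ∀ σ, ∫⁻ x, ENNReal.ofReal (frobeniusNormSq (Gψ σ x)) < ⊤ := fun σ =>
    lintegral_frobeniusNormSq_fderiv_heatTest_lt_top hφ ν _
  have hGψm : ∀ σ, AEStronglyMeasurable (Gψ σ) volume := fun σ =>
    (hψG σ).aestronglyMeasurable_deriv
  have hφL2 : MemLp φ 2 volume := hφ.memLp_volume 2
  have hψle : ∀ σ, eLpNorm (ψ σ) 2 volume ≤ eLpNorm φ 2 volume := fun σ =>
    eLpNorm_heatFlow_le_of_memLp hφL2 one_le_two _
  -- ### the force: a.e. `L²` slices and a finite `L¹_t L²_x` norm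
  have hIf : ∫⁻ s in Ioo 0 T, eLpNorm (f s) 2 volume < ⊤ :=
    lintegral_eLpNorm_two_slice_lt_top_of_eLpNorm_prod hfm hf2
  have hfsl : ∀ᵐ s ∂(volume.restrict (Ioo 0 T)), MemLp (f s) 2 volume :=
    ae_memLp_two_slice_of_eLpNorm_prod hfm hf2
  have hF2m : AEMeasurable (fun s => eLpNorm (f s) 2 volume) (volume.restrict (Ioo 0 T)) := by
    have hm : AEMeasurable (fun s => (∫⁻ x, ‖f s x‖ₑ ^ (2 : ℝ) ∂volume) ^ (1 / 2 : ℝ))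
        (volume.restrict (Ioo 0 T)) :=
      ((hfm.enorm.pow_const _).lintegral_prod_right').pow_const _
    refine hm.congr (ae_of_all _ fun s => ?_)
    simp only
    rw [eLpNorm_eq_lintegral_rpow_enorm_toReal two_ne_zero ENNReal.ofNat_ne_top, ENNReal.toReal_ofNat]
  -- ### the flux `B σ τ = B(τ; ∇ψ(σ))`, the force pairing `P σ τ = ⟨f(τ), ψ(σ)⟩` and the
  -- forced `H¹_σ` time-slice identity
  set B : ℝ → ℝ → ℝ := fun σ τ => (∫ x, ⟪Gψ σ x (u τ x), u τ x⟫) -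
    ν * ∑ i, ∫ x, ⟪Gu τ x (b i), Gψ σ x (b i)⟫ with hB
  set P : ℝ → ℝ → ℝ := fun σ τ => ∫ x, ⟪f τ x, ψ σ x⟫ with hPdef
  have hstar : ∀ σ, ∀ s ∈ Ioc 0 T, ∫ x, ⟪u s x, ψ σ x⟫ =
      (∫ x, ⟪u₀ x, ψ σ x⟫) + ∫ τ in Ioc 0 s, (B σ τ + P σ τ) := fun σ s hs =>
    hu.inner_weakGrad_test_eq_forced hE3 hu₀ hT hfm hf2 hGum hGu hGu₂ (hψ2 σ) (hψdiv σ) (hψG σ)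
      (hGψ2 σ) hs
  have hBint : ∀ σ, IntegrableOn (B σ) (Ioc 0 T) := fun σ =>
    (integrableOn_Ioc_iff_integrableOn_Ioo (hb := enorm_ne_top)).2
      (hu.integrableOn_weakFlux hE3 hGum hGu hGu₂ (hGψm σ) (hGψ2 σ))
  have hPint : ∀ σ, IntegrableOn (P σ) (Ioc 0 T) := fun σ =>
    (integrableOn_Ioc_iff_integrableOn_Ioo (hb := enorm_ne_top)).2
      (integrableOn_forcePairing_of_eLpNorm_prod hfm hf2 (hψ2 σ))
  have hBPint : ∀ σ, IntegrableOn (fun τ => B σ τ + P σ τ) (Ioc 0 T) := fun σ =>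
    (hBint σ).add (hPint σ)
  -- pointwise bounds of the force pairing at the times where `f(τ) ∈ L²`
  have hPbound : ∀ τ, MemLp (f τ) 2 volume → ∀ σ,
      ‖P σ τ‖ₑ ≤ eLpNorm (f τ) 2 volume * eLpNorm φ 2 volume := by
    intro τ hfτ σ
    simp only [hPdef]
    exact (FunctionSpaces.enorm_integral_inner_le_eLpNorm_mul hfτ.1 (hψ2 σ).1).trans
      (mul_le_mul' le_rfl (hψle σ))
  have hPsub : ∀ τ, MemLp (f τ) 2 volume → ∀ σ, σ ≤ τ → τ ≤ t →
      ‖P σ τ - P τ τ‖ₑ ≤ eLpNorm (f τ) 2 volume *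
        (ENNReal.ofReal (τ - σ) * (ENNReal.ofReal ν * eLpNorm (Δ φ) 2 volume)) := by
    intro τ hfτ σ hστ hτt
    simp only [hPdef]
    rw [← integral_sub (integrable_inner_of_memLp_two hfτ (hψ2 σ))
      (integrable_inner_of_memLp_two hfτ (hψ2 τ))]
    have : (fun x => ⟪f τ x, ψ σ x⟫ - ⟪f τ x, ψ τ x⟫) = fun x => ⟪f τ x, (ψ σ - ψ τ) x⟫ := by
      ext x; rw [Pi.sub_apply, inner_sub_right]
    rw [this]
    refine (FunctionSpaces.enorm_integral_inner_le_eLpNorm_mul hfτ.1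
      ((hψ2 σ).sub (hψ2 τ)).1).trans ?_
    refine mul_le_mul' le_rfl ?_
    have h := eLpNorm_heatTest_sub_le (F' := E) hφ2 hφ.hasCompactSupport hν hστ hτt
    have e : ψ σ - ψ τ = -(heatTest ν φ (t - τ) - heatTest ν φ (t - σ)) := by
      simp only [hψ, neg_sub]
    rw [e, eLpNorm_neg]
    exact h
  -- ### the time derivative `Dψ σ = -νΔψ(σ)` and the pairing `g s σ = ⟨u s, Dψ σ⟩`
  set Dψ : ℝ → E → E := fun σ x => -(ν • heatFlow (Δ φ) (ν * (t - σ)) x) with hDψ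
  set g : ℝ → ℝ → ℝ := fun s σ => ∫ x, ⟪u s x, Dψ σ x⟫ with hg
  have hΔφ2 : MemLp (Δ φ) 2 volume := hφ.memLp_laplacian 2
  have hDψ2 : ∀ σ, MemLp (Dψ σ) 2 volume := fun σ =>
    ((memLp_heatFlow_of_memLp hΔφ2 one_le_two _).const_smul ν).neg
  have hPL : ∀ s ∈ Icc 0 T, ∀ σ₁ σ₂, σ₁ ≤ σ₂ → σ₂ ≤ t →
      (∫ x, ⟪u s x, ψ σ₂ x⟫) - ∫ x, ⟪u s x, ψ σ₁ x⟫ = ∫ σ in Ioc σ₁ σ₂, g s σ := by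
    intro s hs σ₁ σ₂ h12 h2t
    rw [← intervalIntegral.integral_of_le h12]
    exact integral_inner_heatTest_sub_eq (hL2 s hs) hφ2 hφ.hasCompactSupport hν h12 h2t
  set Kg : ℝ≥0∞ := ENNReal.ofReal ν * (M * eLpNorm (Δ φ) 2 volume) with hKg
  have hKgtop : Kg ≠ ⊤ :=
    ENNReal.mul_ne_top ENNReal.ofReal_ne_top (ENNReal.mul_ne_top hMtop hΔφ2.eLpNorm_ne_top)
  have hgb : ∀ s ∈ Icc 0 T, ∀ σ, ‖g s σ‖ ≤ Kg.toReal := by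
    intro s hs σ
    refine norm_le_toReal_of_enorm_le hKgtop ?_
    refine (enorm_integral_inner_heatFlow_laplacian_le (hL2 s hs) hφ2 hφ.hasCompactSupport
      hν.le _).trans ?_
    rw [hKg]; gcongr; exact hM s hs
  -- measurability of `g s` (a parametric integral of a jointly measurable integrand)
  have hgm : ∀ s ∈ Icc 0 T, AEStronglyMeasurable (g s) volume := by
    intro s hs
    have hDc : Continuous fun q : ℝ × E => Dψ q.1 q.2 := continuous_heatTestDeriv hφ2 hφ.hasCompactSupport ν t
    have hm : AEStronglyMeasurable (fun q : ℝ × E => ⟪u s q.2, Dψ q.1 q.2⟫)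
        ((volume : Measure ℝ).prod (volume : Measure E)) :=
      AEStronglyMeasurable.inner (𝕜 := ℝ) (hL2 s hs).1.comp_snd hDc.aestronglyMeasurable
    exact hm.integral_prod_right'
  have hgi : ∀ s ∈ Icc 0 T, ∀ S : Set ℝ, volume S < ⊤ → IntegrableOn (g s) S := by
    intro s hs S hS
    haveI : IsFiniteMeasure (volume.restrict S) := ⟨by rwa [Measure.restrict_apply_univ]⟩
    exact Integrable.mono' (integrable_const Kg.toReal) (hgm s hs).restrict
      (ae_of_all _ fun σ => hgb s hs σ)
  -- ### the uniform partition and the cell functions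
  set sp : ℕ → ℕ → ℝ := fun n k => t * k / n with hsp
  set H : ℕ → ℕ → ℝ → ℝ := fun n k τ => (B (sp n k) τ + P (sp n k) τ) + g (sp n (k + 1)) τ with hH
  set Hn : ℕ → ℝ → ℝ := fun n τ =>
    ∑ k ∈ Finset.range n, (Ioc (sp n k) (sp n (k + 1))).indicator (H n k) τ with hHn
  have hsp0 : ∀ n, sp n 0 = 0 := fun n => by simp [hsp]
  have hspn : ∀ n, 0 < n → sp n n = t := fun n hn => by
    rw [hsp]; field_simp
  have hsp_mono : ∀ n k, sp n k ≤ sp n (k + 1) := fun n k => by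
    simp only [hsp]
    rcases Nat.eq_zero_or_pos n with h0 | hpos
    · simp [h0]
    · exact div_le_div_of_nonneg_right
        (mul_le_mul_of_nonneg_left (by exact_mod_cast Nat.le_succ k) ht0.le) (Nat.cast_pos.2 hpos).le
  have hsp_nonneg : ∀ n k, 0 ≤ sp n k := fun n k => by simp only [hsp]; positivity
  have hsp_le : ∀ n k, 0 < n → k ≤ n → sp n k ≤ t := fun n k hn hk => by
    simp only [hsp]
    rw [div_le_iff₀ (Nat.cast_pos.2 hn)]
    exact mul_le_mul_of_nonneg_left (Nat.cast_le.2 hk) ht0.le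
  have hsp_pos : ∀ n k, 0 < n → 0 < k → 0 < sp n k := fun n k hn hk => by
    simp only [hsp]; exact div_pos (mul_pos ht0 (Nat.cast_pos.2 hk)) (Nat.cast_pos.2 hn)
  have hsp_succ : ∀ n k, 0 < n → sp n (k + 1) = sp n k + t / n := fun n k hn => by
    simp only [hsp]; push_cast; ring
  -- ### the partition identity
  have hident : ∀ n, 0 < n → ∫ x, ⟪u t x, φ x⟫ =
      (∫ x, ⟪u₀ x, ψ 0 x⟫) + ∫ τ in Ioc 0 t, Hn n τ := by
    intro n hn
    set p : ℕ → ℝ := fun k => if k = 0 then ∫ x, ⟪u₀ x, ψ 0 x⟫ else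
      ∫ x, ⟪u (sp n k) x, ψ (sp n k) x⟫ with hp
    have hp0 : p 0 = ∫ x, ⟪u₀ x, ψ 0 x⟫ := by simp [hp]
    have hpn : p n = ∫ x, ⟪u t x, φ x⟫ := by
      simp only [hp, if_neg hn.ne', hspn n hn, hψ, sub_self, heatTest_zero_right]
    -- one cell
    have hcell : ∀ k, k < n → p (k + 1) - p k = ∫ τ in Ioc (sp n k) (sp n (k + 1)), H n k τ := by
      intro k hk
      have hk1 : sp n (k + 1) ∈ Ioc 0 T :=
        ⟨hsp_pos n (k + 1) hn k.succ_pos, (hsp_le n (k + 1) hn hk).trans htT⟩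
      have hk1' : sp n (k + 1) ∈ Icc 0 T := Ioc_subset_Icc_self hk1
      -- step A: moving the test field
      have hA : (∫ x, ⟪u (sp n (k + 1)) x, ψ (sp n (k + 1)) x⟫) -
          ∫ x, ⟪u (sp n (k + 1)) x, ψ (sp n k) x⟫ =
            ∫ σ in Ioc (sp n k) (sp n (k + 1)), g (sp n (k + 1)) σ :=
        hPL _ hk1' _ _ (hsp_mono n k) (hsp_le n (k + 1) hn hk)
      -- step B: moving the velocity
      have hB' : (∫ x, ⟪u (sp n (k + 1)) x, ψ (sp n k) x⟫) - p k =
          ∫ τ in Ioc (sp n k) (sp n (k + 1)), (B (sp n k) τ + P (sp n k) τ) := by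
        rcases Nat.eq_zero_or_pos k with hk0 | hkpos
        · subst hk0
          rw [hp0, hsp0, hstar 0 _ hk1]
          ring
        · have hkT : sp n k ∈ Ioc 0 T :=
            ⟨hsp_pos n k hn hkpos, (hsp_le n k hn hk.le).trans htT⟩
          have hpk : p k = ∫ x, ⟪u (sp n k) x, ψ (sp n k) x⟫ := by simp [hp, hkpos.ne']
          rw [hpk, hstar (sp n k) _ hk1, hstar (sp n k) _ hkT]
          have hunion : Ioc 0 (sp n (k + 1)) = Ioc 0 (sp n k) ∪ Ioc (sp n k) (sp n (k + 1)) :=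
            (Ioc_union_Ioc_eq_Ioc (hsp_nonneg n k) (hsp_mono n k)).symm
          have hdisj : Disjoint (Ioc 0 (sp n k)) (Ioc (sp n k) (sp n (k + 1))) :=
            Ioc_disjoint_Ioc_of_le le_rfl
          rw [hunion, setIntegral_union hdisj measurableSet_Ioc
            ((hBPint _).mono_set (Ioc_subset_Ioc_right hkT.2))
            ((hBPint _).mono_set (Ioc_subset_Ioc hkT.1.le hk1.2))]
          ring
      -- step C
      have hp1 : p (k + 1) = ∫ x, ⟪u (sp n (k + 1)) x, ψ (sp n (k + 1)) x⟫ := by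
        simp [hp]
      have hgi' : IntegrableOn (g (sp n (k + 1))) (Ioc (sp n k) (sp n (k + 1))) :=
        hgi _ hk1' _ (by rw [Real.volume_Ioc]; exact ENNReal.ofReal_lt_top)
      have hBi' : IntegrableOn (fun τ => B (sp n k) τ + P (sp n k) τ)
          (Ioc (sp n k) (sp n (k + 1))) :=
        (hBPint _).mono_set (Ioc_subset_Ioc (hsp_nonneg n k) hk1.2)
      calc p (k + 1) - p k = ((∫ x, ⟪u (sp n (k + 1)) x, ψ (sp n (k + 1)) x⟫) -
            ∫ x, ⟪u (sp n (k + 1)) x, ψ (sp n k) x⟫) +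
            ((∫ x, ⟪u (sp n (k + 1)) x, ψ (sp n k) x⟫) - p k) := by rw [hp1]; ring
        _ = (∫ σ in Ioc (sp n k) (sp n (k + 1)), g (sp n (k + 1)) σ) +
            ∫ τ in Ioc (sp n k) (sp n (k + 1)), (B (sp n k) τ + P (sp n k) τ) := by rw [hA, hB']
        _ = ∫ τ in Ioc (sp n k) (sp n (k + 1)), H n k τ := by
            rw [← integral_add hgi' hBi']
            exact integral_congr_ae (ae_of_all _ fun τ => by simp only [hH]; ring)
    -- summing the cells
    have hsum : ∑ k ∈ Finset.range n, (p (k + 1) - p k) = p n - p 0 := Finset.sum_range_sub p n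
    have hsum' : ∑ k ∈ Finset.range n, (p (k + 1) - p k) = ∫ τ in Ioc 0 t, Hn n τ := by
      rw [hHn]
      have hint : ∀ k ∈ Finset.range n, Integrable
          ((Ioc (sp n k) (sp n (k + 1))).indicator (H n k)) (volume.restrict (Ioc 0 t)) := by
        intro k hk
        have hk' := Finset.mem_range.1 hk
        have hk1' : sp n (k + 1) ∈ Icc 0 T :=
          ⟨hsp_nonneg n _, (hsp_le n (k + 1) hn hk').trans htT⟩
        refine IntegrableOn.integrable_indicator ?_ measurableSet_Ioc
        refine IntegrableOn.restrict ?_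
        refine (IntegrableOn.add ((hBPint _).mono_set (Ioc_subset_Ioc (hsp_nonneg n k)
          ((hsp_le n (k + 1) hn hk').trans htT))) (hgi _ hk1' _ ?_))
        rw [Real.volume_Ioc]; exact ENNReal.ofReal_lt_top
      rw [integral_finsetSum _ hint]
      refine Finset.sum_congr rfl fun k hk => ?_
      have hk' := Finset.mem_range.1 hk
      rw [hcell k hk', setIntegral_indicator measurableSet_Ioc,
        inter_eq_right.2 (Ioc_subset_Ioc (hsp_nonneg n k) (hsp_le n (k + 1) hn hk'))]
    rw [← hpn, ← hp0, ← hsum', hsum]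
    ring
  -- ### good times: finite dissipation, `L⁴` slices, finite weight
  set W : ℝ → ℝ≥0∞ := fun τ => eLpNorm (u τ) 4 volume ^ (2 : ℝ) + ENNReal.ofReal |ν| *
    ∑ i, eLpNorm (fun x => Gu τ x (b i)) 2 volume with hW
  have hIW : ∫⁻ τ in Ioo 0 T, W τ < ⊤ := hu.lintegral_weight_lt_top hE3 hGum hGu hGu₂
  have hWm : AEMeasurable W (volume.restrict (Ioo 0 T)) := by
    refine ((FunctionSpaces.aemeasurable_eLpNorm_slice hu.aestronglyMeasurable_uncurry 4).pow_const _).add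
      (AEMeasurable.const_mul (Finset.aemeasurable_fun_sum _ fun i _ => ?_) _)
    exact (FunctionSpaces.measurable_eLpNorm_slice (g := fun s x => Gu s x (b i))
      ((ContinuousLinearMap.apply ℝ E (b i)).continuous.comp_stronglyMeasurable hGum) 2).aemeasurable
  set Dd : ℝ → ℝ≥0∞ := fun τ => ∫⁻ x, ENNReal.ofReal (frobeniusNormSq (Gu τ x)) with hDd
  have hDdm : Measurable Dd := measurable_lintegral_frobeniusNormSq hGum
  have hDfin : ∀ᵐ τ ∂(volume.restrict (Ioo 0 T)), Dd τ < ⊤ := ae_lt_top hDdm hGu₂.ne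
  have hWfin : ∀ᵐ τ ∂(volume.restrict (Ioo 0 T)), W τ < ⊤ := ae_lt_top' hWm hIW.ne
  have h4fin : ∀ᵐ τ ∂(volume.restrict (Ioo 0 T)), eLpNorm (u τ) 4 volume < ⊤ := by
    filter_upwards [hWfin] with τ hτ
    have : eLpNorm (u τ) 4 volume ^ (2 : ℝ) < ⊤ := lt_of_le_of_lt le_self_add hτ
    exact (ENNReal.rpow_lt_top_iff_of_pos zero_lt_two).1 this
  -- the same facts a.e. on `(0, t)`
  set μt : Measure ℝ := volume.restrict (Ioo 0 t) with hμt
  have hsubT : Ioo 0 t ⊆ Ioo 0 T := Ioo_subset_Ioo le_rfl htT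
  have hμle : μt ≤ volume.restrict (Ioo 0 T) := Measure.restrict_mono hsubT le_rfl
  have hGu' : ∀ᵐ τ ∂μt, HasWeakGradient (u τ) (Gu τ) := ae_mono hμle hGu
  have hDfin' : ∀ᵐ τ ∂μt, Dd τ < ⊤ := ae_mono hμle hDfin
  have hWfin' : ∀ᵐ τ ∂μt, W τ < ⊤ := ae_mono hμle hWfin
  have h4fin' : ∀ᵐ τ ∂μt, eLpNorm (u τ) 4 volume < ⊤ := ae_mono hμle h4fin
  have hmemt : ∀ᵐ τ ∂μt, τ ∈ Ioo 0 t := ae_restrict_mem measurableSet_Ioo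
  have hfsl' : ∀ᵐ τ ∂μt, MemLp (f τ) 2 volume := ae_mono hμle hfsl
  have hF2m' : AEMeasurable (fun s => eLpNorm (f s) 2 volume) μt := hF2m.mono_measure hμle
  have hIf' : ∫⁻ τ, eLpNorm (f τ) 2 volume ∂μt < ⊤ :=
    lt_of_le_of_lt (lintegral_mono' hμle le_rfl) hIf
  -- ### uniform Frobenius `L²` bound of `∇ψ(σ)` and the modulus of continuity
  set CF : ℝ≥0∞ := ∑ i, eLpNorm (fun y => fderiv ℝ φ y (b i)) 2 volume ^ 2 with hCF
  have hCFtop : CF ≠ ⊤ := by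
    refine (ENNReal.sum_lt_top.2 fun i _ => ENNReal.pow_lt_top ?_).ne
    exact ((hφ.fderiv_apply_const (b i)).memLp_volume 2).eLpNorm_lt_top
  have hGψle : ∀ σ, ∫⁻ x, ENNReal.ofReal (frobeniusNormSq (Gψ σ x)) ≤ CF := by
    intro σ
    rw [lintegral_ofReal_frobeniusNormSq_eq_sum (hGψm σ), hCF]
    refine Finset.sum_le_sum fun i _ => ?_
    have heq : (fun x => Gψ σ x (b i)) = heatTest ν (fun y => fderiv ℝ φ y (b i)) (t - σ) :=
      funext fun x => fderiv_heatTest_apply hφ ν _ x (b i)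
    have h1 : ∫⁻ x, ‖Gψ σ x (b i)‖ₑ ^ (2 : ℝ) = eLpNorm (fun x => Gψ σ x (b i)) 2 volume ^ 2 := by
      rw [eLpNorm_two_sq_eq_lintegral]
      exact lintegral_congr fun x => by rw [ENNReal.rpow_two]
    rw [h1, heq]
    gcongr
    exact eLpNorm_heatFlow_le_of_memLp ((hφ.fderiv_apply_const (b i)).memLp_volume 2)
      one_le_two _
  set CΔ : ℝ≥0∞ := ∑ i, (ENNReal.ofReal ν *
    eLpNorm (Δ (fun y => fderiv ℝ φ y (b i))) 2 volume) ^ 2 with hCΔ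
  have hCΔtop : CΔ ≠ ⊤ := by
    refine (ENNReal.sum_lt_top.2 fun i _ => ENNReal.pow_lt_top (ENNReal.mul_lt_top
      ENNReal.ofReal_lt_top ?_)).ne
    exact ((hφ.fderiv_apply_const (b i)).memLp_laplacian 2).eLpNorm_lt_top
  have hGψsub : ∀ σ τ, σ ≤ τ → τ ≤ t →
      ∫⁻ x, ENNReal.ofReal (frobeniusNormSq (Gψ σ x - Gψ τ x)) ≤
        ENNReal.ofReal (τ - σ) ^ 2 * CΔ := by
    intro σ τ hστ hτt
    have h := lintegral_frobeniusNormSq_fderiv_heatTest_sub_le hφ hν hστ hτt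
    refine le_trans (le_of_eq (lintegral_congr fun x => ?_)) h
    rw [frobeniusNormSq_sub_comm]
  -- ### the flux bounds at good times
  have hBbound : ∀ τ, HasWeakGradient (u τ) (Gu τ) → Dd τ < ⊤ → eLpNorm (u τ) 4 volume < ⊤ →
      τ ∈ Ioo 0 T → ∀ σ, ‖B σ τ‖ₑ ≤ CF ^ (1 / 2 : ℝ) * W τ := by
    intro τ hGτ hDτ h4τ hτ σ
    have hmem4 : MemLp (u τ) 4 volume := ⟨(hL2 τ (Ioo_subset_Icc_self hτ)).1, h4τ⟩
    have hGi : ∀ i, MemLp (fun x => Gu τ x (b i)) 2 volume := fun i => hGτ.memLp_apply hDτ i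
    have h := enorm_weakFlux_sub_le hmem4 hGτ.aestronglyMeasurable_deriv hGi (hGψm σ)
      (aestronglyMeasurable_const (b := (0 : E →L[ℝ] E))) (hGψ2 σ) (by simp) ν
    simp only [_root_.zero_apply, inner_zero_left, inner_zero_right,
      integral_zero, Finset.sum_const_zero, mul_zero, sub_zero] at h
    refine h.trans ?_
    gcongr
    exact hGψle σ
  have hBsub : ∀ τ, HasWeakGradient (u τ) (Gu τ) → Dd τ < ⊤ → eLpNorm (u τ) 4 volume < ⊤ →
      τ ∈ Ioo 0 t → ∀ σ, σ ≤ τ →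
        ‖B σ τ - B τ τ‖ₑ ≤ (ENNReal.ofReal (τ - σ) ^ 2 * CΔ) ^ (1 / 2 : ℝ) * W τ := by
    intro τ hGτ hDτ h4τ hτ σ hστ
    have hmem4 : MemLp (u τ) 4 volume := ⟨(hL2 τ (Ioo_subset_Icc_self (hsubT hτ))).1, h4τ⟩
    have hGi : ∀ i, MemLp (fun x => Gu τ x (b i)) 2 volume := fun i => hGτ.memLp_apply hDτ i
    have h := enorm_weakFlux_sub_le hmem4 hGτ.aestronglyMeasurable_deriv hGi (hGψm σ) (hGψm τ)
      (hGψ2 σ) (hGψ2 τ) ν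
    refine h.trans ?_
    gcongr
    exact hGψsub σ τ hστ hτ.2.le
  -- ### dominated convergence on `(0, t)`
  have hWm' : AEMeasurable W μt := hWm.mono_measure hμle
  set bound : ℝ → ℝ := fun τ => (CF ^ (1 / 2 : ℝ) * W τ).toReal +
    (eLpNorm (f τ) 2 volume * eLpNorm φ 2 volume).toReal + Kg.toReal with hbound
  have hPdom_int : Integrable (fun τ => (eLpNorm (f τ) 2 volume * eLpNorm φ 2 volume).toReal) μt := by
    refine integrable_toReal_of_lintegral_ne_top (hF2m'.mul_const _) ?_
    rw [lintegral_mul_const'' _ hF2m']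
    exact ENNReal.mul_ne_top hIf'.ne hφL2.eLpNorm_ne_top
  have hbound_int : Integrable bound μt := by
    refine Integrable.add (Integrable.add ?_ hPdom_int) (integrable_const _)
    refine integrable_toReal_of_lintegral_ne_top (hWm'.const_mul _) ?_
    have hCF2 : CF ^ (1 / 2 : ℝ) ≠ ⊤ := ENNReal.rpow_ne_top_of_nonneg (by norm_num) hCFtop
    rw [lintegral_const_mul'' _ hWm']
    refine ENNReal.mul_ne_top hCF2 (lt_of_le_of_lt (lintegral_mono' hμle le_rfl) hIW).ne
  -- measurability of the cell functions
  have hBm : ∀ σ, AEStronglyMeasurable (B σ) μt := fun σ =>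
    (aestronglyMeasurable_weakFlux (hGψm σ) hu.aestronglyMeasurable_uncurry hGum ν).mono_measure hμle
  have hPm : ∀ σ, AEStronglyMeasurable (P σ) μt := fun σ =>
    (aestronglyMeasurable_forcePairing hfm (hψ2 σ).1).mono_measure hμle
  have hHnm : ∀ n, 0 < n → AEStronglyMeasurable (Hn n) μt := by
    intro n hn
    refine Finset.aestronglyMeasurable_fun_sum (Finset.range n) fun k hk => ?_
    have hk' := Finset.mem_range.1 hk
    have hk1' : sp n (k + 1) ∈ Icc 0 T := ⟨hsp_nonneg n _, (hsp_le n (k + 1) hn hk').trans htT⟩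
    exact (((hBm _).add (hPm _)).add ((hgm _ hk1').restrict)).indicator measurableSet_Ioc
  -- pointwise bound
  have hHn_le : ∀ n, ∀ᵐ τ ∂μt, ‖Hn (n + 1) τ‖ ≤ bound τ := by
    intro n
    filter_upwards [hGu', hDfin', h4fin', hWfin', hmemt, hfsl'] with τ hGτ hDτ h4τ hWτ hτ hfτ
    obtain ⟨k, hk, hτk⟩ := exists_mem_Ioc_partition ht0 (Nat.succ_pos n) ⟨hτ.1, hτ.2.le⟩
    have heval : Hn (n + 1) τ = H (n + 1) k τ :=
      sum_indicator_partition_eq ht0 (Nat.succ_pos n) (H (n + 1)) hk hτk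
    rw [heval]
    have hk1' : sp (n + 1) (k + 1) ∈ Icc 0 T :=
      ⟨hsp_nonneg _ _, (hsp_le (n + 1) (k + 1) (Nat.succ_pos n) hk).trans htT⟩
    have hCW : CF ^ (1 / 2 : ℝ) * W τ ≠ ⊤ :=
      ENNReal.mul_ne_top (ENNReal.rpow_ne_top_of_nonneg (by norm_num) hCFtop) hWτ.ne
    have hPW : eLpNorm (f τ) 2 volume * eLpNorm φ 2 volume ≠ ⊤ :=
      ENNReal.mul_ne_top hfτ.eLpNorm_ne_top hφL2.eLpNorm_ne_top
    calc ‖H (n + 1) k τ‖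
        ≤ ‖B (sp (n + 1) k) τ + P (sp (n + 1) k) τ‖ + ‖g (sp (n + 1) (k + 1)) τ‖ :=
          norm_add_le _ _
      _ ≤ (‖B (sp (n + 1) k) τ‖ + ‖P (sp (n + 1) k) τ‖) + ‖g (sp (n + 1) (k + 1)) τ‖ :=
          add_le_add (norm_add_le _ _) le_rfl
      _ ≤ ((CF ^ (1 / 2 : ℝ) * W τ).toReal +
            (eLpNorm (f τ) 2 volume * eLpNorm φ 2 volume).toReal) + Kg.toReal :=
          add_le_add (add_le_add
            (norm_le_toReal_of_enorm_le hCW (hBbound τ hGτ hDτ h4τ (hsubT hτ) _))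
            (norm_le_toReal_of_enorm_le hPW (hPbound τ hfτ _))) (hgb _ hk1' _)
  -- pointwise convergence
  have hHn_lim : ∀ᵐ τ ∂μt, Tendsto (fun n => Hn (n + 1) τ) atTop
      (𝓝 ((B τ τ + P τ τ) + g τ τ)) := by
    filter_upwards [hGu', hDfin', h4fin', hWfin', hmemt, hfsl'] with τ hGτ hDτ h4τ hWτ hτ hfτ
    have hex : ∀ n : ℕ, ∃ k, k < n + 1 ∧ τ ∈ Ioc (sp (n + 1) k) (sp (n + 1) (k + 1)) := fun n =>
      exists_mem_Ioc_partition ht0 (Nat.succ_pos n) ⟨hτ.1, hτ.2.le⟩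
    choose kn hkn hτkn using hex
    have heval : ∀ n, Hn (n + 1) τ = (B (sp (n + 1) (kn n)) τ + P (sp (n + 1) (kn n)) τ) +
        g (sp (n + 1) (kn n + 1)) τ :=
      fun n => sum_indicator_partition_eq ht0 (Nat.succ_pos n) (H (n + 1)) (hkn n) (hτkn n)
    -- the mesh
    have hmesh : ∀ n, sp (n + 1) (kn n + 1) = sp (n + 1) (kn n) + t / ((n : ℝ) + 1) := by
      intro n
      rw [hsp_succ (n + 1) (kn n) (Nat.succ_pos n)]
      push_cast; ring
    have hmesh0 : Tendsto (fun n : ℕ => t / ((n : ℝ) + 1)) atTop (𝓝 0) := by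
      have := tendsto_one_div_add_atTop_nhds_zero_nat.const_mul t
      rw [mul_zero] at this
      exact this.congr fun n => by ring
    have hσle : ∀ n, sp (n + 1) (kn n) ≤ τ := fun n => (hτkn n).1.le
    have hσge : ∀ n : ℕ, τ - t / ((n : ℝ) + 1) ≤ sp (n + 1) (kn n) := fun n => by
      have := (hτkn n).2; rw [hmesh n] at this; linarith
    -- (i) the flux term
    have hBlim : Tendsto (fun n => B (sp (n + 1) (kn n)) τ) atTop (𝓝 (B τ τ)) := by
      refine tendsto_of_enorm_sub_le
        (e := fun n => (ENNReal.ofReal (t / ((n : ℝ) + 1)) ^ 2 * CΔ) ^ (1 / 2 : ℝ) * W τ)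
        (fun n => ?_) ?_
      · refine (hBsub τ hGτ hDτ h4τ hτ _ (hσle n)).trans ?_
        gcongr
        linarith [hσge n]
      · have h1 : Tendsto (fun n : ℕ => ENNReal.ofReal (t / ((n : ℝ) + 1))) atTop (𝓝 0) := by
          have := ENNReal.tendsto_ofReal hmesh0
          rwa [ENNReal.ofReal_zero] at this
        have h2 : Tendsto (fun n : ℕ => ENNReal.ofReal (t / ((n : ℝ) + 1)) ^ 2 * CΔ) atTop (𝓝 0) := by
          have := ENNReal.Tendsto.mul_const ((ENNReal.Tendsto.pow (n := 2) h1)) (Or.inr hCΔtop)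
          simpa using this
        have h3 : Tendsto (fun n : ℕ => (ENNReal.ofReal (t / ((n : ℝ) + 1)) ^ 2 * CΔ) ^ (1 / 2 : ℝ))
            atTop (𝓝 0) := by
          have := h2.ennrpow_const (1 / 2 : ℝ)
          rwa [ENNReal.zero_rpow_of_pos (by norm_num)] at this
        have h4 := ENNReal.Tendsto.mul_const h3 (Or.inr hWτ.ne)
        rwa [zero_mul] at h4
    -- (i') the force pairing: `L²`-Lipschitz continuity of `σ ↦ ψ σ`
    have hPlim : Tendsto (fun n => P (sp (n + 1) (kn n)) τ) atTop (𝓝 (P τ τ)) := by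
      refine tendsto_of_enorm_sub_le
        (e := fun n => eLpNorm (f τ) 2 volume *
          (ENNReal.ofReal (t / ((n : ℝ) + 1)) * (ENNReal.ofReal ν * eLpNorm (Δ φ) 2 volume)))
        (fun n => ?_) ?_
      · refine (hPsub τ hfτ _ (hσle n) hτ.2.le).trans ?_
        gcongr
        linarith [hσge n]
      · have h1 : Tendsto (fun n : ℕ => ENNReal.ofReal (t / ((n : ℝ) + 1))) atTop (𝓝 0) := by
          have := ENNReal.tendsto_ofReal hmesh0
          rwa [ENNReal.ofReal_zero] at this
        have h2 : Tendsto (fun n : ℕ => ENNReal.ofReal (t / ((n : ℝ) + 1)) *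
            (ENNReal.ofReal ν * eLpNorm (Δ φ) 2 volume)) atTop (𝓝 0) := by
          have := ENNReal.Tendsto.mul_const h1 (Or.inr (ENNReal.mul_ne_top
            (ENNReal.ofReal_ne_top (r := ν)) hΔφ2.eLpNorm_ne_top))
          simpa using this
        have h3 := ENNReal.Tendsto.const_mul h2 (Or.inr hfτ.eLpNorm_ne_top)
        rwa [mul_zero] at h3
    -- (ii) the pairing term: weak continuity of `u` at `τ`
    have hglim : Tendsto (fun n => g (sp (n + 1) (kn n + 1)) τ) atTop (𝓝 (g τ τ)) := by
      have hτT : τ ∈ Ioc 0 T := ⟨hτ.1, hτ.2.le.trans htT⟩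
      have hwc := ((hu.weak_continuous (Dψ τ) (hDψ2 τ)).1 τ hτT).tendsto
      have hs : Tendsto (fun n => sp (n + 1) (kn n + 1)) atTop (𝓝[Ioc 0 T] τ) := by
        refine tendsto_nhdsWithin_iff.2 ⟨?_, Eventually.of_forall fun n => ?_⟩
        · refine tendsto_of_tendsto_of_tendsto_of_le_of_le tendsto_const_nhds
            (?_ : Tendsto (fun n : ℕ => τ + t / ((n : ℝ) + 1)) atTop (𝓝 τ)) (fun n => (hτkn n).2)
            (fun n => by rw [hmesh n]; linarith [hσle n])
          have := hmesh0.const_add τ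
          rwa [add_zero] at this
        · exact ⟨hτ.1.trans_le (hτkn n).2,
            (hsp_le (n + 1) (kn n + 1) (Nat.succ_pos n) (hkn n)).trans htT⟩
      exact hwc.comp hs
    exact ((hBlim.add hPlim).add hglim).congr fun n => (heval n).symm
  have hDCT := tendsto_integral_of_dominated_convergence bound (fun n => hHnm (n + 1) (Nat.succ_pos n))
    hbound_int hHn_le hHn_lim
  -- ### the sequence of integrals is constant
  have hconst : ∀ n, ∫ τ, Hn (n + 1) τ ∂μt = (∫ x, ⟪u t x, φ x⟫) - ∫ x, ⟪u₀ x, ψ 0 x⟫ := by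
    intro n
    rw [hμt, ← integral_Ioc_eq_integral_Ioo, hident (n + 1) (Nat.succ_pos n)]
    ring
  have hlimval : (∫ x, ⟪u t x, φ x⟫) - ∫ x, ⟪u₀ x, ψ 0 x⟫ =
      ∫ τ, ((B τ τ + P τ τ) + g τ τ) ∂μt := by
    have h1 : Tendsto (fun _ : ℕ => (∫ x, ⟪u t x, φ x⟫) - ∫ x, ⟪u₀ x, ψ 0 x⟫) atTop
        (𝓝 (∫ τ, ((B τ τ + P τ τ) + g τ τ) ∂μt)) := hDCT.congr hconst
    exact tendsto_nhds_unique tendsto_const_nhds h1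
  -- ### identification of the limit integrand: the viscous terms cancel
  have hid : ∀ᵐ τ ∂μt, (B τ τ + P τ τ) + g τ τ =
      (∫ x, ⟪u τ x, convect (u τ) (ψ τ) x⟫) + P τ τ := by
    filter_upwards [hGu', hDfin', hmemt] with τ hGτ hDτ hτ
    have hτT : τ ∈ Icc 0 T := ⟨hτ.1.le, hτ.2.le.trans htT⟩
    have hGi : ∀ i, MemLp (fun x => Gu τ x (b i)) 2 volume := fun i => hGτ.memLp_apply hDτ i
    have hibp := hGτ.integral_inner_laplacian_of_memLp (hL2 τ hτT) hGi
      (contDiff_heatTest hφ ν (t - τ)) (fun i => memLp_fderiv_heatTest_apply hφ ν _ (b i))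
      (fun i => memLp_fderiv_fderiv_heatTest_apply hφ ν _ (b i))
    have hDψeq : ∀ x, Dψ τ x = -(ν • (Δ (ψ τ)) x) := fun x => by
      simp only [hDψ, hψ, laplacian_heatTest hφ]
      rfl
    have hgval : g τ τ = ν * ∑ i, ∫ x, ⟪Gu τ x (b i), Gψ τ x (b i)⟫ := by
      simp only [hg]
      have h1 : (fun x => ⟪u τ x, Dψ τ x⟫) = fun x => -ν * ⟪u τ x, (Δ (ψ τ)) x⟫ := by
        ext x; rw [hDψeq x, inner_neg_right, real_inner_smul_right]; ring
      rw [h1, integral_const_mul, hibp]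
      ring
    have hBval : B τ τ = (∫ x, ⟪Gψ τ x (u τ x), u τ x⟫) -
        ν * ∑ i, ∫ x, ⟪Gu τ x (b i), Gψ τ x (b i)⟫ := rfl
    have hBg : B τ τ + g τ τ = ∫ x, ⟪u τ x, convect (u τ) (ψ τ) x⟫ := by
      rw [hBval, hgval, sub_add_cancel]
      refine integral_congr_ae (ae_of_all _ fun x => ?_)
      show ⟪Gψ τ x (u τ x), u τ x⟫ = ⟪u τ x, convect (u τ) (ψ τ) x⟫
      rw [convect_apply]
      exact real_inner_comm _ _
    rw [← hBg]; ring
  -- ### conclusion: the diagonal force pairing is integrable, so the limit integral splits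
  have hPdm : AEStronglyMeasurable (fun τ => P τ τ) μt := by
    obtain ⟨Cφ, hCφ⟩ :=
      hφ.contDiff.continuous.bounded_above_of_compact_support hφ.hasCompactSupport
    have hψc : Continuous fun q : ℝ × E => ψ q.1 q.2 := by
      have h1 : Continuous fun q : ℝ × E => heatFlow φ (ν * (t - q.1)) q.2 :=
        (continuous_uncurry_heatFlow hφ.contDiff.continuous hCφ).comp
          ((continuous_const.mul (continuous_const.sub continuous_fst)).prodMk continuous_snd)
      exact h1
    have h1 : AEStronglyMeasurable (fun q : ℝ × E => ⟪uncurry f q, ψ q.1 q.2⟫)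
        (((volume : Measure ℝ).restrict (Ioo 0 T)).prod (volume : Measure E)) :=
      hfm.inner hψc.aestronglyMeasurable
    exact (h1.integral_prod_right').mono_measure hμle
  have hPdi : Integrable (fun τ => P τ τ) μt := by
    refine Integrable.mono' hPdom_int hPdm ?_
    filter_upwards [hfsl'] with τ hfτ
    exact norm_le_toReal_of_enorm_le
      (ENNReal.mul_ne_top hfτ.eLpNorm_ne_top hφL2.eLpNorm_ne_top) (hPbound τ hfτ τ)
  have hXi : Integrable (fun τ => ∫ x, ⟪u τ x, convect (u τ) (ψ τ) x⟫) μt := by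
    have hlim_m : AEStronglyMeasurable (fun τ => (B τ τ + P τ τ) + g τ τ) μt :=
      aestronglyMeasurable_of_tendsto_ae atTop (fun n => hHnm (n + 1) (Nat.succ_pos n)) hHn_lim
    have hlim_int : Integrable (fun τ => (B τ τ + P τ τ) + g τ τ) μt := by
      refine hbound_int.mono' hlim_m ?_
      have hall : ∀ᵐ τ ∂μt, ∀ n, ‖Hn (n + 1) τ‖ ≤ bound τ := ae_all_iff.2 hHn_le
      filter_upwards [hall, hHn_lim] with τ h1 h2
      exact le_of_tendsto' h2.norm h1
    refine ((hlim_int.congr hid).sub hPdi).congr (ae_of_all _ fun τ => ?_)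
    simp only [Pi.sub_apply, add_sub_cancel_right]
  have hfin : ∫ τ, ((B τ τ + P τ τ) + g τ τ) ∂μt =
      (∫ τ in Ioc 0 t, ∫ x, ⟪u τ x, convect (u τ) (heatTest ν φ (t - τ)) x⟫) +
        ∫ τ in Ioc 0 t, ∫ x, ⟪f τ x, heatTest ν φ (t - τ) x⟫ := by
    rw [integral_congr_ae hid, integral_add hXi hPdi, hμt, integral_Ioc_eq_integral_Ioo,
      integral_Ioc_eq_integral_Ioo]
  have hψ0 : ψ 0 = heatTest ν φ t := by simp only [hψ, sub_zero]
  rw [hfin, hψ0] at hlimval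
  linarith

end MainForced

end Literature.Analysis.FluidPDE

end
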